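import Mathlib.RingTheory.Polynomial.Cyclotomic.Roots
import Mathlib.LinearAlgebra.Matrix.Charpoly.Minpoly
import Mathlib.Data.Nat.Factorization.Basic
import Mathlib.Data.Nat.Totient
import HarnessLib

/-!
# The crystallographic restriction: a matrix of finite order `n` over `ℚ` (or `ℤ`) of size `m` has
# `ψ(n) ≤ m` (Bamberg–Cairns–Kilminster 2003, Thm. 1, necessity)

Layer `Literature/LinearAlgebra/Matrix`, namespace `Literature.LinearAlgebra.Matrix`. Pure linear
algebra over `ℚ` (Mathlib only); consumed by `Literature/Geometry/Kaehler/ComplexTorusAutomorphismOrder`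
(lane `lit-hodgefound`, the erratum to Lange 2023 §2.4.5 Exercise (10): the rational representation of an
automorphism of finite order of a `g`-dimensional complex torus is an integer `2g × 2g` matrix of the same
order). One definition with body (`crPsi`, the function `ψ`) and theorems; no named fact.

Source (held copy `paper:doi-10-2307-3647934`, chunk p0001): J. Bamberg, G. Cairns, D. Kilminster, *The
crystallographic restriction, permutations, and Goldbach's conjecture*, Amer. Math. Monthly 110 (2003)
202–209. Quoted [p0001 L10–L12, L28–L41]: "In dimension `n`, the crystallographic restriction (CR) is the
set `Ord_n` of finite orders realized by `n × n` integer matrices: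
`Ord_n = {m ∈ ℕ | ∃A ∈ GL(n, ℤ) with Ord(A) = m}`. […] To describe the CR, define a function
`ψ : ℕ → ℕ ∪ {0}` as follows. For an odd prime `p` and `r = 1, 2, …`, set `ψ(p^r) = φ(p^r)`, where `φ` is
the Euler totient function: `φ(p^r) = p^r − p^{r−1}`. Set `ψ(2^r) = φ(2^r)` for `r > 1`, `ψ(2) = 0`, and
`ψ(1) = 0`. For each `i` in `ℕ`, let `pᵢ` denote the `i`th prime, and for `m` in `ℕ` with prime
factorization `m = ∏ᵢ pᵢ^{rᵢ}` set `ψ(m) = Σᵢ ψ(pᵢ^{rᵢ})` […] Then the CR in dimension `n` is given by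
[29],[30]: **Theorem 1.** `Ord_n = {m ∈ ℕ | ψ(m) ≤ n}`." [p0002 L38–L39]: "For a proof of this theorem
[…] see the excellent introductory account in [12]" (= J. Kuzmanovich, A. Pavlichenkov, *Finite groups of
matrices whose entries are integers*, Amer. Math. Monthly 109 (2002) 173–186, Thm. 2.7).

## What is proved: the inclusion `Ord_m ⊆ {n | ψ(n) ≤ m}`, over `ℚ`

The function `ψ` is `crPsi` (`crPsi_prime_pow`: `ψ(p^r) = φ(p^r)` unless `p^r = 2`; `crPsi_two`,
`crPsi_prime`, `crPsi_one`). For a square matrix `A` over `ℚ` of finite order `n` (indexed by a finite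
type `ι`, `m = #ι`):

* `minpoly_dvd_X_pow_orderOf_sub_one` — `minpoly A ∣ Xⁿ − 1`;
* `prod_cyclotomic_filter_dvd_minpoly` — with `S = cyclotomicDivisors A = {d ∣ n : Φ_d ∣ minpoly A}`,
  `∏_{d ∈ S} Φ_d ∣ minpoly A` (distinct cyclotomic polynomials over `ℚ` are coprime, Mathlib
  `cyclotomic.isCoprime_rat`);
* `minpoly_dvd_prod_cyclotomic_filter` — conversely `minpoly A ∣ ∏_{d ∈ S} Φ_d` (`Xⁿ − 1 = ∏_{d ∣ n} Φ_d`
  and `minpoly A` is coprime to the irreducible `Φ_d` it does not contain);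
* `exists_ordProj_dvd_of_mem_primeFactors_orderOf` — **for every prime `p ∣ n` some `d ∈ S` is divisible
  by the full power `p^{v_p(n)}`** (otherwise every `d ∈ S` divides `n/p`, so `minpoly A ∣ X^{n/p} − 1`
  and `A^{n/p} = 1`);
* `sum_totient_filter_le_card` — `Σ_{d ∈ S} φ(d) ≤ #ι` (degrees: `∏_{d∈S} Φ_d ∣ minpoly A ∣ charpoly A`);
* the (private) arithmetic lemma `sum_le_prod_of_two_le` (`Σ_T f ≤ ∏_U f` for `T ⊆ U`, `f ≥ 1` on `U`,
  `f ≥ 2` on `T`) and `crPsi_le_sum_totient` (`ψ(n) ≤ Σ_{d ∈ S} φ(d)` whenever every `p^{v_p(n)}` divides some `d ∈ S`,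
  all `d ∈ S` dividing `n`: assign each prime to such a `d` and use `φ(d) = ∏_{q^k ‖ d} φ(q^k)`,
  `φ(q^k) ≥ 2` unless `q^k = 2`);
* **`crPsi_orderOf_le_card`** (`ℚ`) and **`crPsi_orderOf_le_card_int`** (`ℤ`): **`ψ(ord A) ≤ #ι`** —
  Theorem 1, the inclusion `⊆`; `crPsi_le_card_of_pow_eq_one_int` (the same with the order given as
  `Aⁿ = 1`, `Aᵐ ≠ 1` for `0 < m < n`).

## Table 1 of [BCK] in ranks `≤ 6`

* `crPsi_mul_of_coprime` — `ψ(mn) = ψ(m) + ψ(n)` for coprime `m, n` (the definition read on `mn`);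
  `totient_ordProj_le_crPsi` — one summand: `φ(p^{v_p(n)}) ≤ ψ(n)` unless `p^{v_p(n)} = 2`;
* **`crPsi_le_two_iff` / `crPsi_le_four_iff` / `crPsi_le_six_iff`** — for `n ≥ 1`:
  `ψ(n) ≤ 2 ↔ n ∈ {1, 2, 3, 4, 6}` ("`Ord₂`", p. 1), `ψ(n) ≤ 4 ↔ n ∈ {1, 2, 3, 4, 5, 6, 8, 10, 12}`,
  `ψ(n) ≤ 6 ↔ n ∈ {1, …, 10, 12, 14, 15, 18, 20, 24, 30}` (Table 1, rows `n ≤ 6`: every prime factor is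
  `≤ 7` with bounded exponent, then a finite `decide`); numerical forms `le_six_of_crPsi_le_two`,
  `le_twelve_of_crPsi_le_four`, `le_thirty_of_crPsi_le_six`;
* for integer matrices of size `≤ 2`, `≤ 4`, `≤ 6` of finite order: **`orderOf_mem_of_card_le_two`**
  (`ord A ∈ {1, 2, 3, 4, 6}`), **`orderOf_mem_of_card_le_four`**, **`orderOf_mem_of_card_le_six`**,
  `orderOf_le_thirty_of_card_le_six`.

Not here: the converse inclusion (block sums of companion matrices of `Φ_{pᵢ^{rᵢ}}` realise every `n` with
`ψ(n) ≤ m`), i.e. `-- TODO(general form): Ord_m ⊇ {n | ψ(n) ≤ m}`; in particular the sharpness of the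
lists above (`30 ∈ Ord₆`, `12 ∈ Ord₄`) is not asserted.

## References

* [BambergCairnsKilminster2003] J. Bamberg, G. Cairns, D. Kilminster, *The crystallographic restriction,
  permutations, and Goldbach's conjecture*, Amer. Math. Monthly 110 (2003), Thm. 1 (held
  `paper:doi-10-2307-3647934`, p. 1).
* [KuzmanovichPavlichenkov2002] J. Kuzmanovich, A. Pavlichenkov, *Finite groups of matrices whose entries
  are integers*, Amer. Math. Monthly 109 (2002) 173–186, Thm. 2.7 (the proof referred to by [BCK]).
-/

noncomputable section

open Polynomial Finset Function

namespace Literature.LinearAlgebra.Matrix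

/-! ### The function `ψ` -/

/-- **The function `ψ` of the crystallographic restriction**: `ψ(n) = Σ_{p ∣ n} ψ(p^{v_p(n)})` with
`ψ(p^r) = φ(p^r)` except `ψ(2) = 0` (and `ψ(1) = 0`, the empty sum).
[cite: BambergCairnsKilminster2003, Thm. 1 (definition of ψ)] -/
def crPsi (n : ℕ) : ℕ :=
  ∑ p ∈ n.primeFactors, if p ^ n.factorization p = 2 then 0 else Nat.totient (p ^ n.factorization p)

/-- Unfolding of `crPsi`. [cite: BambergCairnsKilminster2003, Thm. 1 (definition of ψ)] -/
theorem crPsi_def (n : ℕ) :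
    crPsi n = ∑ p ∈ n.primeFactors,
      if p ^ n.factorization p = 2 then 0 else Nat.totient (p ^ n.factorization p) :=
  rfl

/-- `ψ(1) = 0`. [cite: BambergCairnsKilminster2003, Thm. 1 (definition of ψ)] -/
@[simp] theorem crPsi_one : crPsi 1 = 0 := by
  simp [crPsi]

/-- `ψ(p^r) = φ(p^r)` for a prime power `p^r ≠ 2` (`r ≥ 1`), and `ψ(2) = 0`.
[cite: BambergCairnsKilminster2003, Thm. 1 (definition of ψ)] -/
theorem crPsi_prime_pow {p r : ℕ} (hp : p.Prime) (hr : r ≠ 0) :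
    crPsi (p ^ r) = if p ^ r = 2 then 0 else Nat.totient (p ^ r) := by
  rw [crPsi, Nat.primeFactors_prime_pow hr hp, Finset.sum_singleton, hp.factorization_pow,
    Finsupp.single_eq_same]

/-- `ψ(2) = 0`. [cite: BambergCairnsKilminster2003, Thm. 1 (definition of ψ)] -/
@[simp] theorem crPsi_two : crPsi 2 = 0 := by
  simpa using crPsi_prime_pow Nat.prime_two one_ne_zero

/-- `ψ(p) = p − 1` for an odd prime `p`. [cite: BambergCairnsKilminster2003, Thm. 1 (definition of ψ)] -/
theorem crPsi_prime {p : ℕ} (hp : p.Prime) (hp2 : p ≠ 2) : crPsi p = p - 1 := by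
  simpa [hp2, Nat.totient_prime hp] using crPsi_prime_pow hp one_ne_zero

/-! ### An arithmetic lemma: a sum of integers `≥ 2` is at most their product -/

/-- For a non-empty finset `T` and `f ≥ 2` on `T`: `Σ_T f ≤ ∏_T f`. [folklore] -/
private theorem sum_le_prod_of_two_le_aux {α : Type*} [DecidableEq α] {T : Finset α} (hT : T.Nonempty)
    {f : α → ℕ} (hf : ∀ a ∈ T, 2 ≤ f a) : ∑ a ∈ T, f a ≤ ∏ a ∈ T, f a := by
  induction hT using Finset.Nonempty.cons_induction with
  | singleton a => simp
  | cons a T ha hT ih =>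
    rw [Finset.sum_cons, Finset.prod_cons]
    have hfa : 2 ≤ f a := hf a (Finset.mem_cons_self a T)
    have hih : ∑ x ∈ T, f x ≤ ∏ x ∈ T, f x := ih fun b hb ↦ hf b (Finset.mem_cons_of_mem hb)
    obtain ⟨b, hb⟩ := hT
    have hP : 2 ≤ ∏ x ∈ T, f x :=
      le_trans (hf b (Finset.mem_cons_of_mem hb))
        (Finset.single_le_prod' (fun c hc ↦ le_trans (by norm_num) (hf c (Finset.mem_cons_of_mem hc))) hb)
    nlinarith

/-- **`Σ_{a ∈ T} f(a) ≤ ∏_{a ∈ U} f(a)`** for `T ⊆ U`, `f ≥ 1` on `U` and `f ≥ 2` on `T` (the product of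
integers `≥ 2` dominates their sum, and further factors `≥ 1` do not decrease it). [folklore] -/
private theorem sum_le_prod_of_two_le {α : Type*} [DecidableEq α] {T U : Finset α} (hTU : T ⊆ U) {f : α → ℕ}
    (h1 : ∀ a ∈ U, 1 ≤ f a) (h2 : ∀ a ∈ T, 2 ≤ f a) : ∑ a ∈ T, f a ≤ ∏ a ∈ U, f a := by
  rcases T.eq_empty_or_nonempty with rfl | hT
  · rw [Finset.sum_empty]
    exact Nat.zero_le _
  · exact (sum_le_prod_of_two_le_aux hT h2).trans (Finset.prod_le_prod_of_subset_of_one_le' hTU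
      fun a ha _ ↦ h1 a ha)

/-! ### `φ(d)` as a product over the prime powers of `d`, and `ψ(n) ≤ Σ_{d ∈ S} φ(d)` -/

/-- `φ(d) = ∏_{q ∈ d.primeFactors} φ(q^{v_q(d)})` (`φ` is multiplicative). [folklore] -/
private theorem totient_eq_prod_primeFactors {d : ℕ} (hd : d ≠ 0) :
    Nat.totient d = ∏ q ∈ d.primeFactors, Nat.totient (q ^ d.factorization q) := by
  rw [Nat.multiplicative_factorization Nat.totient (fun x y h ↦ Nat.totient_mul h) Nat.totient_one hd,
    Finsupp.prod, Nat.support_factorization]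

/-- `φ(q^k) ≥ 2` for a prime power `q^k ≥ 3` (`k ≥ 1`), i.e. unless `q^k = 2`. [folklore] -/
private theorem two_le_totient_prime_pow {q k : ℕ} (hq : q.Prime) (hk : k ≠ 0) (h2 : q ^ k ≠ 2) :
    2 ≤ Nat.totient (q ^ k) := by
  have hpos : 0 < Nat.totient (q ^ k) := Nat.totient_pos.2 (pow_pos hq.pos _)
  have hne1 : Nat.totient (q ^ k) ≠ 1 := by
    rw [Ne, Nat.totient_eq_one_iff]
    rintro (h | h)
    · exact (Nat.one_lt_pow hk hq.one_lt).ne' h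
    · exact h2 h
  omega

/-- **`ψ(n) ≤ Σ_{d ∈ S} φ(d)`** for any finite set `S` of divisors of `n ≠ 0` such that every maximal prime
power `p^{v_p(n)}` of `n` divides some member of `S`: assign to each prime `p ∣ n` such a `d_p ∈ S`; the
primes assigned to one `d` contribute `Σ φ(p^{v_p(n)}) = Σ φ(p^{v_p(d)}) ≤ ∏_{q^k ‖ d} φ(q^k) = φ(d)`
(summands `≥ 2` once the term `p^{v_p} = 2`, of weight `ψ(2) = 0`, is dropped).
[cite: BambergCairnsKilminster2003, Thm. 1 (proof of necessity)] -/
theorem crPsi_le_sum_totient {n : ℕ} (hn : n ≠ 0) (S : Finset ℕ) (hS : ∀ d ∈ S, d ∣ n)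
    (hcover : ∀ p ∈ n.primeFactors, ∃ d ∈ S, p ^ n.factorization p ∣ d) :
    crPsi n ≤ ∑ d ∈ S, Nat.totient d := by
  classical
  -- the assignment `p ↦ d_p`
  choose! c hcS hcdvd using hcover
  -- regroup the sum defining `ψ` along the fibres of `c`
  rw [crPsi_def, ← Finset.sum_fiberwise_of_maps_to (g := c) (fun p hp ↦ hcS p hp)]
  refine Finset.sum_le_sum fun d hd ↦ ?_
  have hd0 : d ≠ 0 := fun h ↦ hn (Nat.eq_zero_of_zero_dvd (h ▸ hS d hd))
  -- on the fibre of `d`, `v_p(n) = v_p(d)`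
  have hval : ∀ p ∈ n.primeFactors.filter (fun p ↦ c p = d), n.factorization p = d.factorization p := by
    intro p hp
    rw [Finset.mem_filter] at hp
    obtain ⟨hp, hpc⟩ := hp
    have hpp : p.Prime := Nat.prime_of_mem_primeFactors hp
    apply le_antisymm
    · rw [← hpp.pow_dvd_iff_le_factorization hd0, ← hpc]
      exact hcdvd p hp
    · exact (Nat.factorization_le_iff_dvd hd0 hn).2 (hS d hd) p
  -- drop the primes with `p^{v_p} = 2` (weight `0`) and compare with the product formula for `φ(d)`
  rw [totient_eq_prod_primeFactors hd0]
  calc ∑ p ∈ n.primeFactors.filter (fun p ↦ c p = d),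
          (if p ^ n.factorization p = 2 then 0 else Nat.totient (p ^ n.factorization p))
      = ∑ p ∈ (n.primeFactors.filter (fun p ↦ c p = d)).filter (fun p ↦ p ^ n.factorization p ≠ 2),
          Nat.totient (p ^ n.factorization p) := by
        rw [Finset.sum_filter (fun p ↦ p ^ n.factorization p ≠ 2)]
        refine Finset.sum_congr rfl fun p _ ↦ ?_
        by_cases h : p ^ n.factorization p = 2
        · rw [if_pos h, if_neg (not_not.2 h)]
        · rw [if_neg h, if_pos h]
    _ = ∑ p ∈ (n.primeFactors.filter (fun p ↦ c p = d)).filter (fun p ↦ p ^ n.factorization p ≠ 2),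
          Nat.totient (p ^ d.factorization p) := by
        refine Finset.sum_congr rfl fun p hp ↦ ?_
        rw [hval p (Finset.mem_of_mem_filter p hp)]
    _ ≤ ∏ q ∈ d.primeFactors, Nat.totient (q ^ d.factorization q) := by
        refine sum_le_prod_of_two_le (fun p hp ↦ ?_) (fun q hq ↦ ?_) (fun p hp ↦ ?_)
        · -- the fibre consists of prime factors of `d`
          have hp' := Finset.mem_of_mem_filter p hp
          rw [Finset.mem_filter] at hp'
          have hpp : p.Prime := Nat.prime_of_mem_primeFactors hp'.1
          have hvp : 0 < n.factorization p := Nat.Prime.factorization_pos_of_dvd hpp hn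
            (Nat.dvd_of_mem_primeFactors hp'.1)
          rw [Nat.mem_primeFactors]
          refine ⟨hpp, ?_, hd0⟩
          exact (dvd_pow_self p hvp.ne').trans (hp'.2 ▸ hcdvd p hp'.1)
        · exact Nat.totient_pos.2 (pow_pos (Nat.prime_of_mem_primeFactors hq).pos _)
        · rw [Finset.mem_filter] at hp
          obtain ⟨hp1, hp2⟩ := hp
          have hp' := Finset.mem_of_mem_filter p hp1
          have hpp : p.Prime := Nat.prime_of_mem_primeFactors hp'
          have hvp : 0 < n.factorization p := Nat.Prime.factorization_pos_of_dvd hpp hn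
            (Nat.dvd_of_mem_primeFactors hp')
          rw [← hval p hp1]
          exact two_le_totient_prime_pow hpp hvp.ne' hp2

/-! ### Matrices of finite order over `ℚ`: the cyclotomic content of the minimal polynomial -/

section Rat

variable {ι : Type*} [Fintype ι] [DecidableEq ι]

/-- A general-ring form of `X^d − 1 ∣ X^m − 1` for `d ∣ m`. [folklore] -/
private theorem X_pow_sub_one_dvd_of_dvd {d m : ℕ} (h : d ∣ m) : (X : ℚ[X]) ^ d - 1 ∣ X ^ m - 1 := by
  obtain ⟨e, rfl⟩ := h
  simpa only [one_pow, pow_mul] using sub_dvd_pow_sub_pow ((X : ℚ[X]) ^ d) 1 e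

/-- **`S(A) = {d ∣ ord A : Φ_d ∣ minpoly A}`**, the cyclotomic content of the minimal polynomial of a
matrix of finite order. [cite: BambergCairnsKilminster2003, Thm. 1 (proof)] -/
def cyclotomicDivisors (A : _root_.Matrix ι ι ℚ) : Finset ℕ :=
  @Finset.filter ℕ (fun d ↦ cyclotomic d ℚ ∣ minpoly ℚ A) (Classical.decPred _) (orderOf A).divisors

/-- Membership in `S(A)`. [cite: BambergCairnsKilminster2003, Thm. 1 (proof)] -/
theorem mem_cyclotomicDivisors {A : _root_.Matrix ι ι ℚ} {d : ℕ} :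
    d ∈ cyclotomicDivisors A ↔ d ∈ (orderOf A).divisors ∧ cyclotomic d ℚ ∣ minpoly ℚ A := by
  simp only [cyclotomicDivisors, Finset.mem_filter]

/-- `minpoly A ∣ X^{ord A} − 1`. [cite: BambergCairnsKilminster2003, Thm. 1 (proof)] -/
theorem minpoly_dvd_X_pow_orderOf_sub_one (A : _root_.Matrix ι ι ℚ) :
    minpoly ℚ A ∣ X ^ orderOf A - 1 := by
  refine minpoly.dvd ℚ A ?_
  simp only [map_sub, map_pow, aeval_X, map_one, pow_orderOf_eq_one, sub_self]

/-- With `S = {d ∣ n : Φ_d ∣ minpoly A}` (`n = ord A`): **`∏_{d ∈ S} Φ_d ∣ minpoly A`** (distinct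
cyclotomic polynomials over `ℚ` are pairwise coprime). [cite: BambergCairnsKilminster2003, Thm. 1 (proof)] -/
theorem prod_cyclotomic_filter_dvd_minpoly (A : _root_.Matrix ι ι ℚ) :
    ∏ d ∈ cyclotomicDivisors A, cyclotomic d ℚ ∣
      minpoly ℚ A :=
  Finset.prod_dvd_of_coprime (fun _ _ _ _ hdd' ↦ cyclotomic.isCoprime_rat hdd')
    fun _ hd ↦ (mem_cyclotomicDivisors.1 hd).2

/-- Conversely **`minpoly A ∣ ∏_{d ∈ S} Φ_d`**: `minpoly A` divides `Xⁿ − 1 = ∏_{d ∣ n} Φ_d` and is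
coprime to every irreducible `Φ_d` (`d ∣ n`) that does not divide it.
[cite: BambergCairnsKilminster2003, Thm. 1 (proof)] -/
theorem minpoly_dvd_prod_cyclotomic_filter (A : _root_.Matrix ι ι ℚ) (hA : 0 < orderOf A) :
    minpoly ℚ A ∣
      ∏ d ∈ cyclotomicDivisors A, cyclotomic d ℚ := by
  classical
  have hX := minpoly_dvd_X_pow_orderOf_sub_one A
  have hsplit : ∏ i ∈ (orderOf A).divisors, cyclotomic i ℚ =
      (∏ d ∈ cyclotomicDivisors A, cyclotomic d ℚ) *
        ∏ d ∈ (orderOf A).divisors.filter (fun d ↦ ¬ cyclotomic d ℚ ∣ minpoly ℚ A), cyclotomic d ℚ := by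
    unfold cyclotomicDivisors
    convert (Finset.prod_filter_mul_prod_filter_not (orderOf A).divisors
      (fun d ↦ cyclotomic d ℚ ∣ minpoly ℚ A) (fun d ↦ cyclotomic d ℚ)).symm
  rw [← prod_cyclotomic_eq_X_pow_sub_one hA, hsplit] at hX
  refine IsCoprime.dvd_of_dvd_mul_right ?_ hX
  refine IsCoprime.prod_right fun d hd ↦ ?_
  rw [Finset.mem_filter] at hd
  obtain ⟨hdn, hnd⟩ := hd
  have hd0 : 0 < d := Nat.pos_of_mem_divisors hdn
  exact ((cyclotomic.irreducible_rat hd0).coprime_iff_not_dvd.2 hnd).symm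

/-- **Every maximal prime power `p^{v_p(n)}` of `n = ord A` divides some `d ∈ S`** (`S` as above):
otherwise all `d ∈ S` divide `n/p`, so `minpoly A ∣ ∏_{d∈S} Φ_d ∣ X^{n/p} − 1` and `A^{n/p} = 1`,
contradicting `ord A = n`. [cite: BambergCairnsKilminster2003, Thm. 1 (proof)] -/
theorem exists_ordProj_dvd_of_mem_primeFactors_orderOf (A : _root_.Matrix ι ι ℚ) (hA : 0 < orderOf A)
    {p : ℕ} (hp : p ∈ (orderOf A).primeFactors) :
    ∃ d ∈ cyclotomicDivisors A,
      p ^ (orderOf A).factorization p ∣ d := by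
  classical
  set n := orderOf A with hn
  have hn0 : n ≠ 0 := hA.ne'
  have hpp : p.Prime := Nat.prime_of_mem_primeFactors hp
  have hpn : p ∣ n := Nat.dvd_of_mem_primeFactors hp
  by_contra hcon
  push Not at hcon
  -- every `d ∈ S` divides `n / p`
  have hdiv : ∀ d ∈ cyclotomicDivisors A, d ∣ n / p := by
    intro d hd
    have hdn : d ∣ n := Nat.dvd_of_mem_divisors (mem_cyclotomicDivisors.1 hd).1
    have hd0 : d ≠ 0 := fun h ↦ hn0 (Nat.eq_zero_of_zero_dvd (h ▸ hdn))
    have hnp0 : n / p ≠ 0 := (Nat.div_pos (Nat.le_of_dvd hA hpn) hpp.pos).ne'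
    rw [← Nat.factorization_le_iff_dvd hd0 hnp0, Nat.factorization_div hpn, hpp.factorization]
    intro q
    rw [Finsupp.coe_tsub, Pi.sub_apply]
    by_cases hqp : q = p
    · subst hqp
      rw [Finsupp.single_eq_same]
      -- `v_p(d) < v_p(n)` since `p^{v_p(n)} ∤ d`
      have hlt : d.factorization q < n.factorization q := by
        by_contra hge
        push Not at hge
        exact hcon d hd ((pow_dvd_pow q hge).trans (Nat.ordProj_dvd d q))
      omega
    · rw [Finsupp.single_apply, if_neg (fun h ↦ hqp h.symm), tsub_zero]
      exact (Nat.factorization_le_iff_dvd hd0 hn0).2 hdn q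
  -- hence `∏_{d ∈ S} Φ_d ∣ X^{n/p} - 1`
  have hprod : ∏ d ∈ cyclotomicDivisors A, cyclotomic d ℚ ∣
      (X : ℚ[X]) ^ (n / p) - 1 :=
    Finset.prod_dvd_of_coprime (fun d _ d' _ hdd' ↦ cyclotomic.isCoprime_rat hdd') fun d hd ↦
      (cyclotomic.dvd_X_pow_sub_one d ℚ).trans (X_pow_sub_one_dvd_of_dvd (hdiv d hd))
  -- so `A^{n/p} = 1`
  have hμ : minpoly ℚ A ∣ (X : ℚ[X]) ^ (n / p) - 1 :=
    (minpoly_dvd_prod_cyclotomic_filter A hA).trans hprod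
  have hpow : A ^ (n / p) = 1 := by
    obtain ⟨r, hr⟩ := hμ
    have h := congrArg (aeval A) hr
    rw [map_mul, minpoly.aeval, zero_mul, map_sub, map_pow, aeval_X, map_one, sub_eq_zero] at h
    exact h
  -- contradicting `ord A = n`
  have hlt : n / p < n := Nat.div_lt_self hA hpp.one_lt
  have hpos : 0 < n / p := Nat.div_pos (Nat.le_of_dvd hA hpn) hpp.pos
  exact absurd (orderOf_le_of_pow_eq_one hpos hpow) (not_le.2 hlt)

/-- **`Σ_{d ∈ S} φ(d) ≤ #ι`**: `∏_{d∈S} Φ_d ∣ minpoly A ∣ charpoly A`, of degree `#ι`.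
[cite: BambergCairnsKilminster2003, Thm. 1 (proof)] -/
theorem sum_totient_filter_le_card (A : _root_.Matrix ι ι ℚ) :
    ∑ d ∈ cyclotomicDivisors A, Nat.totient d ≤
      Fintype.card ι := by
  have hdvd := (prod_cyclotomic_filter_dvd_minpoly A).trans (Matrix.minpoly_dvd_charpoly A)
  have hdeg := natDegree_le_of_dvd hdvd (Matrix.charpoly_monic A).ne_zero
  rw [Matrix.charpoly_natDegree_eq_dim, natDegree_prod _ _ (fun d _ ↦ cyclotomic_ne_zero d ℚ)] at hdeg
  simpa only [natDegree_cyclotomic] using hdeg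

/-- **The crystallographic restriction (necessity), over `ℚ`: `ψ(ord A) ≤ #ι`** for every square matrix
`A ∈ M_ι(ℚ)` of finite order — Bamberg–Cairns–Kilminster's Theorem 1, the inclusion
`Ord ⊆ {m | ψ(m) ≤ n}` (their `n` = our `#ι`). [cite: BambergCairnsKilminster2003, Thm. 1] -/
theorem crPsi_orderOf_le_card (A : _root_.Matrix ι ι ℚ) (hA : 0 < orderOf A) :
    crPsi (orderOf A) ≤ Fintype.card ι :=
  (crPsi_le_sum_totient hA.ne' _ (fun _ hd ↦ Nat.dvd_of_mem_divisors (mem_cyclotomicDivisors.1 hd).1)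
    fun _ hp ↦ exists_ordProj_dvd_of_mem_primeFactors_orderOf A hA hp).trans (sum_totient_filter_le_card A)

/-- **The crystallographic restriction (necessity) for integer matrices: `ψ(ord A) ≤ #ι`** for every
`A ∈ M_ι(ℤ)` of finite order (`Ord_{#ι} ⊆ {m | ψ(m) ≤ #ι}`). [cite: BambergCairnsKilminster2003, Thm. 1] -/
theorem crPsi_orderOf_le_card_int (A : _root_.Matrix ι ι ℤ) (hA : 0 < orderOf A) :
    crPsi (orderOf A) ≤ Fintype.card ι := by
  set F : _root_.Matrix ι ι ℤ →+* _root_.Matrix ι ι ℚ := (Int.castRingHom ℚ).mapMatrix with hF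
  have hinj : Injective F := fun M N h ↦
    _root_.Matrix.map_injective (Int.cast_injective (α := ℚ)) (by simpa [hF] using h)
  have hord : orderOf (F A) = orderOf A := orderOf_injective F.toMonoidHom hinj A
  have h := crPsi_orderOf_le_card (F A) (by rwa [hord])
  rwa [hord] at h

/-- The same bound for an element of finite order given as `Aⁿ = 1`, `n` minimal: `ψ(n) ≤ #ι`.
[cite: BambergCairnsKilminster2003, Thm. 1] -/
theorem crPsi_le_card_of_pow_eq_one_int (A : _root_.Matrix ι ι ℤ) {n : ℕ} (hn : 0 < n) (hAn : A ^ n = 1)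
    (hmin : ∀ m, 0 < m → m < n → A ^ m ≠ 1) : crPsi n ≤ Fintype.card ι := by
  have hord : orderOf A = n := (orderOf_eq_iff hn).2 ⟨hAn, fun m hmn hm0 ↦ hmin m hm0 hmn⟩
  have h := crPsi_orderOf_le_card_int A (by rw [hord]; exact hn)
  rwa [hord] at h

end Rat

/-! ### Additivity of `ψ`, and Table 1 of [BCK] in ranks `≤ 6`: the lists `{m | ψ(m) ≤ 2, 4, 6}` -/

section Table

/-- `ψ(0) = 0` (junk value: `0` has no prime factorisation). [cite: BambergCairnsKilminster2003, Thm. 1 (definition of ψ)] -/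
@[simp] theorem crPsi_zero : crPsi 0 = 0 := by
  simp [crPsi]

/-- **`ψ` is additive over coprime factors: `ψ(mn) = ψ(m) + ψ(n)` for `gcd(m, n) = 1`** — this is
the definition `ψ(m) = Σᵢ ψ(pᵢ^{rᵢ})` read on `m · n`. [cite: BambergCairnsKilminster2003, Thm. 1 (definition of ψ)] -/
theorem crPsi_mul_of_coprime {m n : ℕ} (h : m.Coprime n) : crPsi (m * n) = crPsi m + crPsi n := by
  rcases eq_or_ne m 0 with rfl | hm
  · rw [Nat.coprime_zero_left] at h
    subst h
    simp
  rcases eq_or_ne n 0 with rfl | hn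
  · rw [Nat.coprime_zero_right] at h
    subst h
    simp
  rw [crPsi_def, h.primeFactors_mul, Finset.sum_union h.disjoint_primeFactors, crPsi_def, crPsi_def]
  congr 1
  · refine Finset.sum_congr rfl fun p hp ↦ ?_
    have hp0 : n.factorization p = 0 :=
      Finsupp.notMem_support_iff.1 (Finset.disjoint_left.1 h.disjoint_primeFactors hp)
    rw [Nat.factorization_mul_apply_of_coprime h, hp0, add_zero]
  · refine Finset.sum_congr rfl fun p hp ↦ ?_
    have hp0 : m.factorization p = 0 :=
      Finsupp.notMem_support_iff.1 (Finset.disjoint_right.1 h.disjoint_primeFactors hp)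
    rw [Nat.factorization_mul_apply_of_coprime h, hp0, zero_add]

/-- **One summand of `ψ`: `φ(p^{v_p(n)}) ≤ ψ(n)`** for every prime `p ∣ n` with `p^{v_p(n)} ≠ 2`.
[cite: BambergCairnsKilminster2003, Thm. 1 (definition of ψ)] -/
theorem totient_ordProj_le_crPsi {n p : ℕ} (hp : p ∈ n.primeFactors) (h2 : p ^ n.factorization p ≠ 2) :
    Nat.totient (p ^ n.factorization p) ≤ crPsi n := by
  have h := Finset.single_le_sum
    (f := fun q ↦ if q ^ n.factorization q = 2 then 0 else Nat.totient (q ^ n.factorization q))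
    (fun _ _ ↦ Nat.zero_le _) hp
  simpa only [crPsi_def, if_neg h2] using h

/-- If `ψ(n) ≤ B < φ(p^{r+1}) = p^r (p − 1)` (and `p^{r+1} ≠ 2`), then `v_p(n) ≤ r`. [folklore] -/
private theorem factorization_le_of_crPsi_le {n p r B : ℕ} (hn : n ≠ 0) (hp : p.Prime)
    (h : crPsi n ≤ B) (h2 : 2 < p ^ (r + 1)) (hB : B < p ^ r * (p - 1)) :
    n.factorization p ≤ r := by
  by_contra hlt
  push Not at hlt
  have hv : 0 < n.factorization p := by omega
  have hpmem : p ∈ n.primeFactors :=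
    Nat.mem_primeFactors.2 ⟨hp, Nat.dvd_of_factorization_pos hv.ne', hn⟩
  have hmono : p ^ (r + 1) ≤ p ^ n.factorization p := Nat.pow_le_pow_right hp.pos hlt
  have hne : p ^ n.factorization p ≠ 2 := by omega
  have hkey := (totient_ordProj_le_crPsi hpmem hne).trans h
  rw [Nat.totient_prime_pow hp hv] at hkey
  have hmono' : p ^ r ≤ p ^ (n.factorization p - 1) := Nat.pow_le_pow_right hp.pos (by omega)
  have := Nat.mul_le_mul_right (p - 1) hmono'
  omega

/-- If `ψ(n) ≤ 6` then every prime factor of `n` is one of `2, 3, 5, 7`. [folklore] -/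
private theorem primeFactors_subset_of_crPsi_le_six {n : ℕ} (hn : n ≠ 0) (h : crPsi n ≤ 6) :
    n.primeFactors ⊆ {2, 3, 5, 7} := by
  intro p hp
  have hpp := Nat.prime_of_mem_primeFactors hp
  have hv : 0 < n.factorization p :=
    hpp.factorization_pos_of_dvd hn (Nat.dvd_of_mem_primeFactors hp)
  by_contra hmem
  simp only [Finset.mem_insert, Finset.mem_singleton, not_or] at hmem
  obtain ⟨hp2, hp3, hp5, hp7⟩ := hmem
  have h8 : 8 ≤ p := by
    by_contra hlt
    push Not at hlt
    have h2le := hpp.two_le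
    interval_cases p
    · exact hp2 rfl
    · exact hp3 rfl
    · exact absurd hpp (by decide)
    · exact hp5 rfl
    · exact absurd hpp (by decide)
    · exact hp7 rfl
  have h0 := factorization_le_of_crPsi_le (r := 0) hn hpp h (by rw [zero_add, pow_one]; omega)
    (by rw [pow_zero, one_mul]; omega)
  omega

/-- If the prime factors of `n ≠ 0` are among `2, 3, 5, 7` then `n = 2^{v₂} 3^{v₃} 5^{v₅} 7^{v₇}`. [folklore] -/
private theorem eq_two_three_five_seven {n : ℕ} (hn : n ≠ 0) (h : n.primeFactors ⊆ {2, 3, 5, 7}) :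
    n = 2 ^ n.factorization 2 * (3 ^ n.factorization 3 * (5 ^ n.factorization 5 * 7 ^ n.factorization 7)) := by
  have h0 := Nat.prod_factorization_pow_eq_self hn
  rw [Nat.prod_factorization_eq_prod_primeFactors, Finset.prod_subset h fun p _ hp ↦ by
    rw [Finsupp.notMem_support_iff.1 hp, pow_zero]] at h0
  rw [Finset.prod_insert (by simp), Finset.prod_insert (by simp), Finset.prod_insert (by simp),
    Finset.prod_singleton] at h0
  exact h0.symm

/-- The summand bookkeeping `ψ(p^k)` for a prime `p`, including `k = 0` (plumbing for the finite tables
below, which are closed `decide` goals). [folklore] -/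
private def psiTerm (p k : ℕ) : ℕ := if k = 0 then 0 else if p ^ k = 2 then 0 else Nat.totient (p ^ k)

/-- `ψ(p^k) = psiTerm p k` for a prime `p` and every `k` (`k = 0`: both sides `0`). [folklore] -/
private theorem crPsi_prime_pow_eq_psiTerm {p : ℕ} (hp : p.Prime) (k : ℕ) :
    crPsi (p ^ k) = psiTerm p k := by
  rcases eq_or_ne k 0 with rfl | hk
  · simp [psiTerm]
  · rw [crPsi_prime_pow hp hk, psiTerm, if_neg hk]

/-- `ψ(2^a 3^b 5^c 7^d) = ψ(2^a) + ψ(3^b) + ψ(5^c) + ψ(7^d)` by additivity. [folklore] -/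
private theorem crPsi_two_three_five_seven (a b c d : ℕ) :
    crPsi (2 ^ a * (3 ^ b * (5 ^ c * 7 ^ d))) = psiTerm 2 a + (psiTerm 3 b + (psiTerm 5 c + psiTerm 7 d)) := by
  have h57 : (5 ^ c).Coprime (7 ^ d) := Nat.Coprime.pow c d (by decide)
  have h3 : (3 ^ b).Coprime (5 ^ c * 7 ^ d) :=
    Nat.Coprime.mul_right (Nat.Coprime.pow b c (by decide)) (Nat.Coprime.pow b d (by decide))
  have h2 : (2 ^ a).Coprime (3 ^ b * (5 ^ c * 7 ^ d)) :=
    Nat.Coprime.mul_right (Nat.Coprime.pow a b (by decide))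
      (Nat.Coprime.mul_right (Nat.Coprime.pow a c (by decide)) (Nat.Coprime.pow a d (by decide)))
  have h7 : Nat.Prime 7 := by decide
  rw [crPsi_mul_of_coprime h2, crPsi_mul_of_coprime h3, crPsi_mul_of_coprime h57,
    crPsi_prime_pow_eq_psiTerm Nat.prime_two, crPsi_prime_pow_eq_psiTerm Nat.prime_three,
    crPsi_prime_pow_eq_psiTerm Nat.prime_five, crPsi_prime_pow_eq_psiTerm h7]

/-- For `ψ(n) ≤ 6`, `n ≠ 0`: `n = 2^a 3^b 5^c 7^d` with `a ≤ 3`, `b ≤ 2`, `c ≤ 1`, `d ≤ 1`. [folklore] -/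
private theorem exists_exponents_of_crPsi_le_six {n : ℕ} (hn : n ≠ 0) (h : crPsi n ≤ 6) :
    ∃ a b c d : ℕ, a ≤ 3 ∧ b ≤ 2 ∧ c ≤ 1 ∧ d ≤ 1 ∧ n = 2 ^ a * (3 ^ b * (5 ^ c * 7 ^ d)) :=
  ⟨_, _, _, _,
    factorization_le_of_crPsi_le (p := 2) (r := 3) hn Nat.prime_two h (by norm_num) (by norm_num),
    factorization_le_of_crPsi_le (p := 3) (r := 2) hn Nat.prime_three h (by norm_num) (by norm_num),
    factorization_le_of_crPsi_le (p := 5) (r := 1) hn Nat.prime_five h (by norm_num) (by norm_num),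
    factorization_le_of_crPsi_le (p := 7) (r := 1) hn (by decide) h (by norm_num) (by norm_num),
    eq_two_three_five_seven hn (primeFactors_subset_of_crPsi_le_six hn h)⟩

/-- Evaluation of `ψ(n) ≤ B` for an explicit `n = 2^a 3^b 5^c 7^d`. [folklore] -/
private theorem crPsi_le_of_eq {n B : ℕ} (a b c d : ℕ) (he : n = 2 ^ a * (3 ^ b * (5 ^ c * 7 ^ d)))
    (hB : psiTerm 2 a + (psiTerm 3 b + (psiTerm 5 c + psiTerm 7 d)) ≤ B) : crPsi n ≤ B := by
  rw [he, crPsi_two_three_five_seven]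
  exact hB

set_option synthInstance.maxSize 1024 in
/-- The finite check behind Table 1, rows n ≤ 6: the `48` exponent vectors `(a, b, c, d) ≤ (3, 2, 1, 1)`.
[cite: BambergCairnsKilminster2003, Table 1 (rows n ≤ 6)] -/
private theorem table_six : ∀ a ≤ 3, ∀ b ≤ 2, ∀ c ≤ 1, ∀ d ≤ 1,
    psiTerm 2 a + (psiTerm 3 b + (psiTerm 5 c + psiTerm 7 d)) ≤ 6 →
      2 ^ a * (3 ^ b * (5 ^ c * 7 ^ d)) ∈
        ({1, 2, 3, 4, 5, 6, 7, 8, 9, 10, 12, 14, 15, 18, 20, 24, 30} : Finset ℕ) := by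
  decide

set_option synthInstance.maxSize 1024 in
/-- The finite check behind Table 1, rows n ≤ 4: the `48` exponent vectors `(a, b, c, d) ≤ (3, 2, 1, 1)`.
[cite: BambergCairnsKilminster2003, Table 1 (rows n ≤ 4)] -/
private theorem table_four : ∀ a ≤ 3, ∀ b ≤ 2, ∀ c ≤ 1, ∀ d ≤ 1,
    psiTerm 2 a + (psiTerm 3 b + (psiTerm 5 c + psiTerm 7 d)) ≤ 4 →
      2 ^ a * (3 ^ b * (5 ^ c * 7 ^ d)) ∈ ({1, 2, 3, 4, 5, 6, 8, 10, 12} : Finset ℕ) := by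
  decide

set_option synthInstance.maxSize 1024 in
/-- The finite check behind Table 1, rows n ≤ 2: the `48` exponent vectors `(a, b, c, d) ≤ (3, 2, 1, 1)`.
[cite: BambergCairnsKilminster2003, Table 1 (rows n ≤ 2)] -/
private theorem table_two : ∀ a ≤ 3, ∀ b ≤ 2, ∀ c ≤ 1, ∀ d ≤ 1,
    psiTerm 2 a + (psiTerm 3 b + (psiTerm 5 c + psiTerm 7 d)) ≤ 2 →
      2 ^ a * (3 ^ b * (5 ^ c * 7 ^ d)) ∈ ({1, 2, 3, 4, 6} : Finset ℕ) := by
  decide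

/-- **Table 1 of [BCK] in rank `6`: `{m ≥ 1 | ψ(m) ≤ 6} = {1, 2, 3, 4, 5, 6, 7, 8, 9, 10, 12, 14, 15, 18,
20, 24, 30}`** (`ψ⁻¹{0} = {1, 2}`, `ψ⁻¹{2} = {3, 4, 6}`, `ψ⁻¹{4} = {5, 8, 10, 12}`,
`ψ⁻¹{6} = {7, 9, 14, 15, 18, 20, 24, 30}`). [cite: BambergCairnsKilminster2003, Table 1 (rows n ≤ 6)] -/
theorem crPsi_le_six_iff {n : ℕ} (hn : n ≠ 0) :
    crPsi n ≤ 6 ↔ n ∈ ({1, 2, 3, 4, 5, 6, 7, 8, 9, 10, 12, 14, 15, 18, 20, 24, 30} : Finset ℕ) := by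
  constructor
  · intro h
    obtain ⟨a, b, c, d, ha, hb, hc, hd, rfl⟩ := exists_exponents_of_crPsi_le_six hn h
    rw [crPsi_two_three_five_seven] at h
    exact table_six a ha b hb c hc d hd h
  · intro h
    simp only [Finset.mem_insert, Finset.mem_singleton] at h
    rcases h with rfl | rfl | rfl | rfl | rfl | rfl | rfl | rfl | rfl | rfl | rfl | rfl | rfl | rfl |
      rfl | rfl | rfl
    · exact crPsi_le_of_eq 0 0 0 0 (by norm_num) (by decide)
    · exact crPsi_le_of_eq 1 0 0 0 (by norm_num) (by decide)
    · exact crPsi_le_of_eq 0 1 0 0 (by norm_num) (by decide)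
    · exact crPsi_le_of_eq 2 0 0 0 (by norm_num) (by decide)
    · exact crPsi_le_of_eq 0 0 1 0 (by norm_num) (by decide)
    · exact crPsi_le_of_eq 1 1 0 0 (by norm_num) (by decide)
    · exact crPsi_le_of_eq 0 0 0 1 (by norm_num) (by decide)
    · exact crPsi_le_of_eq 3 0 0 0 (by norm_num) (by decide)
    · exact crPsi_le_of_eq 0 2 0 0 (by norm_num) (by decide)
    · exact crPsi_le_of_eq 1 0 1 0 (by norm_num) (by decide)
    · exact crPsi_le_of_eq 2 1 0 0 (by norm_num) (by decide)
    · exact crPsi_le_of_eq 1 0 0 1 (by norm_num) (by decide)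
    · exact crPsi_le_of_eq 0 1 1 0 (by norm_num) (by decide)
    · exact crPsi_le_of_eq 1 2 0 0 (by norm_num) (by decide)
    · exact crPsi_le_of_eq 2 0 1 0 (by norm_num) (by decide)
    · exact crPsi_le_of_eq 3 1 0 0 (by norm_num) (by decide)
    · exact crPsi_le_of_eq 1 1 1 0 (by norm_num) (by decide)

/-- **Table 1 of [BCK] in rank `4`: `{m ≥ 1 | ψ(m) ≤ 4} = {1, 2, 3, 4, 5, 6, 8, 10, 12}`.**
[cite: BambergCairnsKilminster2003, Table 1 (rows n ≤ 4)] -/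
theorem crPsi_le_four_iff {n : ℕ} (hn : n ≠ 0) :
    crPsi n ≤ 4 ↔ n ∈ ({1, 2, 3, 4, 5, 6, 8, 10, 12} : Finset ℕ) := by
  constructor
  · intro h
    obtain ⟨a, b, c, d, ha, hb, hc, hd, rfl⟩ := exists_exponents_of_crPsi_le_six hn (h.trans (by norm_num))
    rw [crPsi_two_three_five_seven] at h
    exact table_four a ha b hb c hc d hd h
  · intro h
    simp only [Finset.mem_insert, Finset.mem_singleton] at h
    rcases h with rfl | rfl | rfl | rfl | rfl | rfl | rfl | rfl | rfl
    · exact crPsi_le_of_eq 0 0 0 0 (by norm_num) (by decide)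
    · exact crPsi_le_of_eq 1 0 0 0 (by norm_num) (by decide)
    · exact crPsi_le_of_eq 0 1 0 0 (by norm_num) (by decide)
    · exact crPsi_le_of_eq 2 0 0 0 (by norm_num) (by decide)
    · exact crPsi_le_of_eq 0 0 1 0 (by norm_num) (by decide)
    · exact crPsi_le_of_eq 1 1 0 0 (by norm_num) (by decide)
    · exact crPsi_le_of_eq 3 0 0 0 (by norm_num) (by decide)
    · exact crPsi_le_of_eq 1 0 1 0 (by norm_num) (by decide)
    · exact crPsi_le_of_eq 2 1 0 0 (by norm_num) (by decide)

/-- **The classic CR in rank `2`: `{m ≥ 1 | ψ(m) ≤ 2} = {1, 2, 3, 4, 6}`** ("`Ord₂ = {1, 2, 3, 4, 6}`").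
[cite: BambergCairnsKilminster2003, p. 1 (Ord₂) and Table 1] -/
theorem crPsi_le_two_iff {n : ℕ} (hn : n ≠ 0) :
    crPsi n ≤ 2 ↔ n ∈ ({1, 2, 3, 4, 6} : Finset ℕ) := by
  constructor
  · intro h
    obtain ⟨a, b, c, d, ha, hb, hc, hd, rfl⟩ := exists_exponents_of_crPsi_le_six hn (h.trans (by norm_num))
    rw [crPsi_two_three_five_seven] at h
    exact table_two a ha b hb c hc d hd h
  · intro h
    simp only [Finset.mem_insert, Finset.mem_singleton] at h
    rcases h with rfl | rfl | rfl | rfl | rfl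
    · exact crPsi_le_of_eq 0 0 0 0 (by norm_num) (by decide)
    · exact crPsi_le_of_eq 1 0 0 0 (by norm_num) (by decide)
    · exact crPsi_le_of_eq 0 1 0 0 (by norm_num) (by decide)
    · exact crPsi_le_of_eq 2 0 0 0 (by norm_num) (by decide)
    · exact crPsi_le_of_eq 1 1 0 0 (by norm_num) (by decide)

/-- Numerical form: `ψ(n) ≤ 2`, `n ≥ 1` ⇒ `n ≤ 6` (and `n ≠ 5`). [cite: BambergCairnsKilminster2003, p. 1 (Ord₂)] -/
theorem le_six_of_crPsi_le_two {n : ℕ} (hn : n ≠ 0) (h : crPsi n ≤ 2) : n ≤ 6 := by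
  have h' := (crPsi_le_two_iff hn).1 h
  simp only [Finset.mem_insert, Finset.mem_singleton] at h'
  omega

/-- Numerical form: `ψ(n) ≤ 4`, `n ≥ 1` ⇒ `n ≤ 12`. [cite: BambergCairnsKilminster2003, Table 1 (rows n ≤ 4)] -/
theorem le_twelve_of_crPsi_le_four {n : ℕ} (hn : n ≠ 0) (h : crPsi n ≤ 4) : n ≤ 12 := by
  have h' := (crPsi_le_four_iff hn).1 h
  simp only [Finset.mem_insert, Finset.mem_singleton] at h'
  omega

/-- Numerical form: `ψ(n) ≤ 6`, `n ≥ 1` ⇒ `n ≤ 30`. [cite: BambergCairnsKilminster2003, Table 1 (rows n ≤ 6)] -/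
theorem le_thirty_of_crPsi_le_six {n : ℕ} (hn : n ≠ 0) (h : crPsi n ≤ 6) : n ≤ 30 := by
  have h' := (crPsi_le_six_iff hn).1 h
  simp only [Finset.mem_insert, Finset.mem_singleton] at h'
  omega

end Table

/-! ### The crystallographic restriction in ranks `≤ 6`: orders of integer matrices of size `≤ 6` -/

section SmallRank

variable {ι : Type*} [Fintype ι] [DecidableEq ι]

/-- **`Ord₁ ⊆ Ord₂ ⊆ {1, 2, 3, 4, 6}`**: an integer matrix of size `≤ 2` of finite order has order
`1, 2, 3, 4` or `6`. [cite: BambergCairnsKilminster2003, Thm. 1 and p. 1 (Ord₂)] -/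
theorem orderOf_mem_of_card_le_two (A : _root_.Matrix ι ι ℤ) (hA : 0 < orderOf A)
    (h : Fintype.card ι ≤ 2) : orderOf A ∈ ({1, 2, 3, 4, 6} : Finset ℕ) :=
  (crPsi_le_two_iff hA.ne').1 ((crPsi_orderOf_le_card_int A hA).trans h)

/-- **`Ord₃ ⊆ Ord₄ ⊆ {1, 2, 3, 4, 5, 6, 8, 10, 12}`**: an integer matrix of size `≤ 4` of finite order has
order in this list (in particular `≤ 12`). [cite: BambergCairnsKilminster2003, Thm. 1 and Table 1] -/
theorem orderOf_mem_of_card_le_four (A : _root_.Matrix ι ι ℤ) (hA : 0 < orderOf A)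
    (h : Fintype.card ι ≤ 4) : orderOf A ∈ ({1, 2, 3, 4, 5, 6, 8, 10, 12} : Finset ℕ) :=
  (crPsi_le_four_iff hA.ne').1 ((crPsi_orderOf_le_card_int A hA).trans h)

/-- **`Ord₅ ⊆ Ord₆ ⊆ {1, …, 10, 12, 14, 15, 18, 20, 24, 30}`**: an integer matrix of size `≤ 6` of finite
order has order in this list (in particular `≤ 30`; `24` and `30` occur).
[cite: BambergCairnsKilminster2003, Thm. 1 and Table 1] -/
theorem orderOf_mem_of_card_le_six (A : _root_.Matrix ι ι ℤ) (hA : 0 < orderOf A)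
    (h : Fintype.card ι ≤ 6) :
    orderOf A ∈ ({1, 2, 3, 4, 5, 6, 7, 8, 9, 10, 12, 14, 15, 18, 20, 24, 30} : Finset ℕ) :=
  (crPsi_le_six_iff hA.ne').1 ((crPsi_orderOf_le_card_int A hA).trans h)

/-- In particular an integer matrix of size `≤ 6` of finite order has order `≤ 30`.
[cite: BambergCairnsKilminster2003, Thm. 1 and Table 1] -/
theorem orderOf_le_thirty_of_card_le_six (A : _root_.Matrix ι ι ℤ) (hA : 0 < orderOf A)
    (h : Fintype.card ι ≤ 6) : orderOf A ≤ 30 :=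
  le_thirty_of_crPsi_le_six hA.ne' ((crPsi_orderOf_le_card_int A hA).trans h)

end SmallRank

end Literature.LinearAlgebra.Matrix

end
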